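import Summits.RiemannHypothesis.RiemannHypothesis.Theorems.PfPersistenceF1TranslateBound
import HarnessLib

/-!
# PF persistence, fake seat 1 — typed handles for THEOREMS F1-E / F1-F (statements only)

Unit `pub-rhpf-fake-1` of the `pub-rhpf` cell (mechanism / rigidity campaign; **no RH claims**);
companion of `HOME/FAKES.md §1.6–§1.7`.  Nothing here asserts or assumes RH; this file contains
DEFINITIONS and typed `Prop` targets only, plus two one-line structural remarks.

* `LineData`, `LineRepresents F L` — a LINE REPRESENTATION of the quadratic functional of an
  explicit datum `F`: `Q_F(g) = Σⱼ cⱼ |ĝ(1/2 + iγⱼ)|² + (1/2π) ∫ |ĝ(1/2 + it)|² D(t) dt` on Weil tests,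
  with locally finite, polynomially counted line atoms `(γⱼ, cⱼ)` and a continuous, polynomially bounded
  LINE DENSITY `D` (FAKES §1.6.4: for a line-regular g-prime system `P` dressed as `ζ` the explicit
  formula OF `P`, contour-shifted to `Re w = 1/2`, gives `cⱼ = −Res_{ρⱼ}(−ζ_P'/ζ_P)` and
  `D = D_P(t) = Re ψ(1/4 + it/2) − log π − 2 Re(−ζ_P'/ζ_P)(1/2 + it)`; `ζ` itself has `D ≡ 0`, which is
  the functional equation on the critical line).
* `LineDensityCriterion` — THEOREM F1-E (informal; kernel OPEN): under a line representation,
  `F.Positivity ↔ (all cⱼ ≥ 0) ∧ (D ≥ 0)` (a Bochner–Schwartz uniqueness statement for tempered line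
  measures tested against `|ĝ|²`, `g ∈ C_c^∞`).  The window-free non-positivity certificates of the
  DMV `β = 1/2` companions (FAKES §1.7, job `f1-linedensity`) are heights `t₀` with `D_P(t₀) < 0`.
* `IsRegularGSystem`, `RegularRigidity` — THEOREM F1-F (informal; kernel OPEN): a g-prime system
  `P ≠ ℙ` whose log-derivative defect `E_P = Z_ℙ − Z_P` is analytic on `Re w > 1/2` and continuous with
  polynomial growth up to `Re w = 1/2` is not Weil-positive — UNCONDITIONALLY (case `¬RH` by THEOREM
  F1-C / `BoundedTranslatesForceContinuation`, case `RH` by the line density and the 'hole at the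
  origin' of the atomic measure `M_ℙ − M_P`).  `RegularRigidity` is `BeurlingRigidity` restricted to the
  regular class (`regularRigidity_of_beurlingRigidity`).
* `ZetaIsolationSummable` — THEOREM F1-A′ with its RH hypothesis REMOVED (claimed by F1-F, FAKES
  §1.6.5; kernel OPEN); `ZetaIsolationSummableRH` is its trivial consequence.
-/

set_option linter.dupNamespace false

noncomputable section

open MeasureTheory Set Filter Complex
open scoped Real Topology ComplexConjugate ContDiff

namespace Summit.RiemannHypothesis.RiemannHypothesis.Theorems.PfPersistence.Fake1.LineDensity

open Literature.NumberTheory.LFunctions Summit.RiemannHypothesis.RiemannHypothesis.Theorems.PfPersistenceBarrier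
  Summit.RiemannHypothesis.RiemannHypothesis.Theorems.PfPersistenceBarrier.ExplicitDatum
  Summit.RiemannHypothesis.RiemannHypothesis.Theorems.PfPersistence.Fake1
  Summit.RiemannHypothesis.RiemannHypothesis.Theorems.PfPersistence.Fake1.TranslateBound

/-! ## §1 Line representations and the line-density criterion (THEOREM F1-E) -/

/-- LINE DATA of an explicit functional: line atoms `(γ j, c j)` (height, real coefficient; slot `j`
unused when `c j = 0`) and a line density `D`. (A data container for the typed targets below; not a
Literature notion.) -/
structure LineData where
  /-- coefficients of the line atoms (for a g-prime system: minus the residues of `−ζ_P'/ζ_P`) -/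
  c : ℕ → ℝ
  /-- heights of the line atoms -/
  γ : ℕ → ℝ
  /-- the line density (for a g-prime system: `D_P(t) = Re ψ(1/4 + it/2) − log π − 2 Re Z_P(1/2 + it)`) -/
  D : ℝ → ℝ

/-- `L` is a LINE REPRESENTATION of the datum `F` (FAKES §1.6.4): the atoms are locally finite with
distinct heights on the support and polynomially counted, the density is continuous and polynomially
bounded, and for every Weil test `g` the quadratic functional is
`Q_F(g) = Σⱼ cⱼ ‖ĝ(1/2 + iγⱼ)‖² + (1/2π) ∫ ‖ĝ(1/2 + it)‖² D(t) dt` (`ĝ = weilMellin g`; the atomic series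
summable). (A `Prop`: statement only, a problem-side notion of the campaign; not a Literature fact, not
cited from anywhere.) -/
def LineRepresents (F : ExplicitDatum) (L : LineData) : Prop :=
  (∀ T : ℝ, {j : ℕ | |L.γ j| ≤ T ∧ L.c j ≠ 0}.Finite) ∧ Set.InjOn L.γ {j : ℕ | L.c j ≠ 0} ∧
  (∃ C N : ℝ, ∀ T : ℝ, 0 ≤ T → (∑' j : ℕ, if |L.γ j| ≤ T then |L.c j| else 0) ≤ C * (1 + T) ^ N) ∧
  Continuous L.D ∧ (∃ C N : ℝ, ∀ t : ℝ, |L.D t| ≤ C * (1 + |t|) ^ N) ∧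
  ∀ g : ℝ → ℂ, IsWeilTest g →
    Summable (fun j : ℕ ↦ L.c j * ‖weilMellin g (1 / 2 + L.γ j * I)‖ ^ 2) ∧
    F.quadratic g = (((∑' j : ℕ, L.c j * ‖weilMellin g (1 / 2 + L.γ j * I)‖ ^ 2) +
        (1 / (2 * π)) * ∫ t : ℝ, ‖weilMellin g (1 / 2 + t * I)‖ ^ 2 * L.D t : ℝ) : ℂ)

/-- THEOREM F1-E = LINE-DENSITY CRITERION (FAKES §1.6.4; PROVED paper-level: direction `←` is immediate
from the representation, direction `→` is Bochner–Schwartz uniqueness for the tempered signed measure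
`Σ cⱼ δ_{γⱼ} + D(t) dt/2π` tested against `|ĝ(1/2 + it)|²`, `g ∈ C_c^∞`; kernel OPEN): under a line
representation, Weil positivity at all windows holds iff every line atom has a non-negative coefficient and
the line density is non-negative. For `ζ` (granting RH and simple zeros) `cⱼ = 1`, `D ≡ 0`. (A `Prop`:
statement only, a problem-side typed target of the campaign with the label stated above; not a Literature
fact, not cited from anywhere.) -/
def LineDensityCriterion : Prop :=
  ∀ (F : ExplicitDatum) (L : LineData), LineRepresents F L →
    (F.Positivity ↔ (∀ j, 0 ≤ L.c j) ∧ ∀ t, 0 ≤ L.D t)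

/-! ## §2 The regular class and its rigidity (THEOREM F1-F) -/

/-- `(g, m)` is a REGULAR g-prime system dressed as `ζ` (FAKES §1.6.5): generators `g i > 1`, injective,
finitely many below any bound, abscissa `≤ 1` (the weighted atoms of `beurlingDatum g m` are summable
against `e^{−(σ − 1/2)·pos}` for `σ > 1`), and the LOG-DERIVATIVE DEFECT `E_P := Z_ℙ − Z_P`
(`primeDirichlet zetaC − primeDirichlet (beurlingDatum g m)` on `Re w > 1`) continues to a function
analytic on `Re w > 1/2`, continuous on `Re w ≥ 1/2`, of polynomial growth on `1/2 ≤ Re w ≤ 2`.  Contains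
every finite and every `1/2`-summable perturbation of the primes (`Σ (log g) g^{−1/2} < ∞` over the
symmetric difference), e.g. Broucke–Debruyne–Révész `𝒫_β`, `β < 1/2`. (A `Prop`: statement only, a
problem-side notion of the campaign; not a Literature fact, not cited from anywhere.) -/
def IsRegularGSystem (g : ℕ → ℝ) (m : ℕ → ℕ) : Prop :=
  (∀ i, 1 < g i) ∧ Function.Injective g ∧ (∀ B : ℝ, {i : ℕ | g i ≤ B}.Finite) ∧
  (∀ σ : ℝ, 1 < σ → Summable fun n ↦
      ‖(beurlingDatum g m).wt n‖ * Real.exp (-(σ - 1 / 2) * (beurlingDatum g m).pos n)) ∧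
  ∃ E : ℂ → ℂ, DifferentiableOn ℂ E {w : ℂ | 1 / 2 < w.re} ∧ ContinuousOn E {w : ℂ | 1 / 2 ≤ w.re} ∧
    (∃ C N : ℝ, ∀ w : ℂ, 1 / 2 ≤ w.re → w.re ≤ 2 → ‖E w‖ ≤ C * (1 + |w.im|) ^ N) ∧
    ∀ w : ℂ, 1 < w.re → E w = primeDirichlet zetaC w - primeDirichlet (beurlingDatum g m) w

/-- THEOREM F1-F = RIGIDITY ON THE REGULAR CLASS (FAKES §1.6.5; PROVED paper-level, UNCONDITIONAL — case
`¬RH`: THEOREM F1-C (`BoundedTranslatesForceContinuation`) with THEOREM F1-B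
(`beurling_not_positivity_of_unbounded`); case `RH`: the explicit formula for `ζ` as tempered measures,
`W_P(k) − W_ℙ(k) = (1/π) ∫ k̂(1/2 + it) Re E_P(1/2 + it) dt`, positivity of `Re E_P` on the line via
modulated wide bumps, and the hole at the origin of `M_ℙ − M_P` forcing the positive-definite functions
`F_ε` to vanish; kernel OPEN): a regular g-prime system other than the primes is not Weil-positive at all
windows.  Supersedes THEOREM F1-A (`ZetaIsolationFin`) on the Beurling side and removes the RH label of
F1-A′. (A `Prop`: statement only, a problem-side typed target of the campaign with the label stated above;
not a Literature fact, not cited from anywhere.) -/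
def RegularRigidity : Prop :=
  ∀ (g : ℕ → ℝ) (m : ℕ → ℕ), IsRegularGSystem g m →
    (¬ ∀ k : ℝ → ℂ, HasCompactSupport k → (beurlingDatum g m).primeTerm k = zetaC.primeTerm k) →
    ¬ (beurlingDatum g m).Positivity

/-- THEOREM F1-A′ WITHOUT RH (claimed by THEOREM F1-F, FAKES §1.6.5; PROVED paper-level; kernel OPEN): an
absolutely summable nonzero even atomic perturbation of `ζ`'s datum with positive distinct positions is not
Weil-positive — the statement `ZetaIsolationSummableRH` of `PfPersistenceF1Beurling` with its hypothesis
`RiemannHypothesis` deleted. (A `Prop`: statement only, a problem-side typed target of the campaign with the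
label stated above; not a Literature fact, not cited from anywhere.) -/
def ZetaIsolationSummable : Prop :=
  ∀ (F : ExplicitDatum) (x c : ℕ → ℝ), F.smooth = zetaC.smooth → Summable (fun j => |c j|) →
    (∃ j, c j ≠ 0) → (∀ j, 0 < x j) → Function.Injective x →
    (∀ k : ℝ → ℂ, HasCompactSupport k → Continuous k →
      F.primeTerm k = zetaC.primeTerm k + ∑' j, (c j : ℂ) * (k (x j) + k (-(x j)))) →
    ¬ F.Positivity

/-! ## §3 Structural remarks (PROVED, one line each) -/

/-- `RegularRigidity` is the restriction of `BeurlingRigidity` (GAP F1-G-b) to the regular class. -/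
theorem regularRigidity_of_beurlingRigidity (h : BeurlingRigidity) : RegularRigidity :=
  fun g m hreg hne ↦ h g m hreg.1 hreg.2.1 hne

/-- The unconditional F1-A′ implies the RH-conditional one of `PfPersistenceF1Beurling`. -/
theorem zetaIsolationSummableRH_of_summable (h : ZetaIsolationSummable) : ZetaIsolationSummableRH :=
  fun _ ↦ h

end Summit.RiemannHypothesis.RiemannHypothesis.Theorems.PfPersistence.Fake1.LineDensity

end
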